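import Summits.BirchSwinnertonDyer.BirchSwinnertonDyer.Theorems.CMKolyvaginAtInertTwoCMKolyvaginConjectureAtInertTwoSelmerEigenTwistedCorestriction
import HarnessLib

/-!
# Route `CMKolyvaginAtInertTwo`, crux `CMKolyvaginConjectureAtInertTwo` (stmt-BirchSwinnertonDyer-24648),
# stub `stub_positiveDepth` — THE TWISTED CORESTRICTION LAW AT `p^∞` LEVEL, BOTH EIGENPARTS, ANY PRIME `p`:
# `Sel_{p^∞}(E^{(d_K)}/ℚ) = 0 ⟹ 2·Sel_{p^∞}(E_K/K)^− = 0` and `Sel_{p^∞}(E/ℚ) = 0 ⟹ 2·Sel_{p^∞}(E_K/K)^+ = 0`;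
# for odd `p` the eigenparts themselves vanish

Seat `leafhand-bsd-cmkolyvaginatinert-11` g0 (cell `bsd-eis`); helper `--supports stmt-BirchSwinnertonDyer-24648`.
THEOREMS ONLY: no definition, no named fact introduced, no `sorry`; no stub, crux or summit closed; BSD is proved
for no curve.  File 4 of this seat: the `p^∞`-level form of file 1's mechanism, extracted as reusable infrastructure
(file 1 §6 inlined the twist transport for `p = 2` and classes coming from level `2^M`).

* §1 ★ `two_nsmul_eq_zero_of_selmerPInfty_minus_of_twist_selmerPInfty_eq_bot` — `X/ℚ` any Weierstrass curve, `K/ℚ` Galois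
  quadratic (`[K:ℚ] = 2`, `σ₀ ≠ 1`), any `p`: if `Sel_{p^∞}(X^{(d_K)}/ℚ) = 0` then every `t ∈ Sel_{p^∞}(X_K/K)` with
  `(τ₀)_* t = −t` (ANTI-fixed by the chosen lift of `σ₀`) has `2·t = 0`.  Proof: the twist transport `hPsiK⁻¹ t ∈
  Sel_{p^∞}(X^{(d_K)}_K/K)` is `(τ₀)_*`-FIXED by Dokchitser's sign rule (`psiQ_smul_liftToAbsGal`, `h1Equiv_conjH1_neg`,
  `h1Equiv_psiQ_modelIso`, `modelIso_conjH1Primary`), and file 1 §5 (`cor` into `Sel_{p^∞}(X^{(d_K)}/ℚ) = 0`, `res ∘ cor = 2`).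
* §2 `eq_zero_of_selmerPInfty_minus_of_twist_selmerPInfty_eq_bot_of_odd` / `eq_zero_of_selmerPInfty_plus_of_selmerPInfty_eq_bot_of_odd`
  — for ODD `p` the classes themselves vanish (`2` is invertible on a `p`-primary group): `Sel_{p^∞}(X^{(d_K)}/ℚ) = 0 ⟹
  Sel_{p^∞}(X_K/K)^− = 0`, `Sel_{p^∞}(X/ℚ) = 0 ⟹ Sel_{p^∞}(X_K/K)^+ = 0` — the `p^∞` companions of the tree's finite-level
  `Sel_p(E^{(d_K)}/ℚ) ≅ Sel_p(E/K)^−`, `Sel_p(E/ℚ) ≅ Sel_p(E/K)^+` (`SelmerTorsionRestrictionExact`, Gross 1991 §5 (5.1)).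
* §3 `two_nsmul_eq_zero_of_selmerPInfty_minus_of_twinShaTrivial_of_twinRankZero` — §1 with `Sel_{p^∞}(X^{(d_K)}/ℚ) = 0`
  discharged by `rank X^{(d_K)}(ℚ) = 0 ∧ Ш(X^{(d_K)}/ℚ)[p^∞] = 0` (file 1 §1), `X`, `X^{(d_K)}` elliptic.

HONEST FRAMING.  Galois-cohomological bookkeeping (Serre I.§2.4; Kramer 1981 Thm. 1 / Gross 1991 §5 (5.1) mechanism) composed
from tree parts and file 1; nothing here touches the research core of `stub_positiveDepth`; closes nothing; BSD is proved
for no curve.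
References: [cite: GrossLMS1991, §5 (5.1)] [cite: Kramer1981, Thm. 1] [cite: SerreGaloisCohomology1997, I.§2.4 Prop. 9]
[cite: DokchitserDokchitserAnnals2010, Lemma 4.14 (proof)] [cite: Dokchitser2013ParityNotes, §4]
presearch: tree has the finite-level odd-`p` statements (`SelmerTorsionRestrictionExact`) and the `p^∞` decomposition up to
bounded torsion (`BSDSelmerParityDokchitserBaseChangeProofs`, cokernel killed by `8`); the exact `p^∞` eigenpart statements via
Clark–Sharif corestriction are not in the tree (`lean search 'selmerPInfty_minus|eigen.*selmerGroupPInfty'` → none); composition only.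
-/

set_option autoImplicit false
set_option linter.dupNamespace false -- the Theorems namespace repeats the summit name by design (D-0017)

noncomputable section
open scoped Classical
open Field NumberField WeierstrassCurve
open Literature.NumberTheory.EllipticCurves
open Literature.NumberTheory.GaloisRepresentations
open Summit.BirchSwinnertonDyer.BirchSwinnertonDyer.Theorems.GenusExact.PlusDescent (exists_gal_ne_one_sqrt_discr)

namespace Summit.BirchSwinnertonDyer.BirchSwinnertonDyer.Theorems.CMKolyvaginFirstDescentTwoOnGivenFrame

variable (X : WeierstrassCurve ℚ) (K : Type) [Field K] [NumberField K] (p : ℕ)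

/-! ## §1 ★ The minus part: `Sel_{p^∞}(X^{(d_K)}/ℚ) = 0 ⟹ 2·t = 0` for every anti-fixed `t ∈ Sel_{p^∞}(X_K/K)` -/

/-- ★ **THE TWISTED CORESTRICTION LAW AT `p^∞` (minus part).**  `X/ℚ` any Weierstrass curve, `K/ℚ` Galois quadratic (`[K:ℚ] = 2`,
`σ₀ ≠ 1`), any `p`.  If `Sel_{p^∞}(X^{(d_K)}/ℚ) = 0` then every `t ∈ Sel_{p^∞}(X_K/K)` ANTI-fixed by `σ₀` (`(τ₀)_* t = −t` for the
chosen lift, tree `conjH1Primary`) satisfies `2·t = 0`.  Proof: with `θ₀ = √d_K` (`exists_gal_ne_one_sqrt_discr`; `σ₀ = sigmaQ`) the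
twist transport `u := hPsiK⁻¹ t ∈ Sel_{p^∞}(X^{(d_K)}_K/K)` (`mem_selmerGroupPInfty_iff_hPsiK_mem`) is `(τ₀)_*`-FIXED — in the subgroup
model `ψ_* (modelIso u) = modelIso t` (`h1Equiv_psiQ_modelIso`), `ψ_* ∘ c_* = −c_* ∘ ψ_*` (`h1Equiv_conjH1_neg`, `psiQ_smul_liftToAbsGal`),
`modelIso ∘ (τ₀)_* = c_* ∘ modelIso` (`modelIso_conjH1Primary`) — so file 1 §5 gives `2·u = 0`, hence `2·t = hPsiK (2·u) = 0`.
[cite: GrossLMS1991, §5 (5.1)] [cite: Kramer1981, Thm. 1] [cite: Dokchitser2013ParityNotes, §4]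
[cite: SerreGaloisCohomology1997, I.§2.4 Prop. 9] -/
theorem two_nsmul_eq_zero_of_selmerPInfty_minus_of_twist_selmerPInfty_eq_bot [IsGalois ℚ K]
    (h2 : Module.finrank ℚ K = 2) {σ₀ : K ≃ₐ[ℚ] K} (hσ₀ : σ₀ ≠ 1)
    (hbot : selmerGroupPInfty (X.quadraticTwist (NumberField.discr K : ℚ)) p = ⊥)
    {t : galH1Primary (X.baseChange K) p} (ht : t ∈ selmerGroupPInfty (X.baseChange K) p)
    (hanti : (isLiftOfAut_liftAut σ₀).conjH1Primary X p t = -t) : 2 • t = 0 := by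
  set T := X.quadraticTwist (NumberField.discr K : ℚ) with hTdef
  -- `σ₀ = sigmaQ` for `θ₀ = √d_K`
  obtain ⟨τ, θ₀, -, hθ₀Q, hθ₀, -, hall⟩ := exists_gal_ne_one_sqrt_discr K h2
  have hσeq : σ₀ = sigmaQ K h2 hθ₀Q hθ₀ := by
    rcases hall σ₀ with h | h
    · exact absurd h hσ₀
    · rcases hall (sigmaQ K h2 hθ₀Q hθ₀) with h' | h'
      · exact absurd h' (sigmaQ_ne_one K h2 hθ₀Q hθ₀)
      · rw [h, h']
  -- the twist transport `u`
  set u := (hPsiK X K hθ₀Q hθ₀ p).symm t with hudef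
  have hut : hPsiK X K hθ₀Q hθ₀ p u = t := by rw [hudef, AddEquiv.apply_symm_apply]
  have huSel : u ∈ selmerGroupPInfty (T.baseChange K) p := by
    rw [mem_selmerGroupPInfty_iff_hPsiK_mem X K hθ₀Q hθ₀ p u, hut]
    exact ht
  haveI := normal_galRange K h2 hσ₀
  set N := galRange (K := ℚ) K with hN
  set c := liftToAbsGal (K := ℚ) K σ₀ with hc
  set Ψ := h1Equiv (G := ↥N) (psiQ X K hθ₀Q hθ₀ p) (psiQ_smul X K hθ₀Q hθ₀ p) with hΨ
  have hΨu : Ψ (modelIso K T p u) = modelIso K X p t := by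
    rw [hΨ, h1Equiv_psiQ_modelIso X K hθ₀Q hθ₀ p u, hut]
  -- `c_*` acts as `−1` on `modelIso t`
  have hEside : conjH1 N (geomPrimaryTorsion X p) c (modelIso K X p t) = -modelIso K X p t := by
    rw [hc, ← modelIso_conjH1Primary K X p σ₀ h2 hσ₀ t, hanti, map_neg]
  have hantiψ : ∀ m' : geomPrimaryTorsion T p,
      psiQ X K hθ₀Q hθ₀ p (c • m') = -(c • psiQ X K hθ₀Q hθ₀ p m') := by
    intro m'
    rw [hc, hσeq]
    exact psiQ_smul_liftToAbsGal X K h2 hθ₀Q hθ₀ p m'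
  have hufix_model : conjH1 N (geomPrimaryTorsion T p) c (modelIso K T p u) = modelIso K T p u := by
    apply Ψ.injective
    rw [hΨ, h1Equiv_conjH1_neg (psiQ X K hθ₀Q hθ₀ p) (psiQ_smul X K hθ₀Q hθ₀ p) hantiψ, ← hΨ, hΨu, hEside, neg_neg]
  have hufix : (isLiftOfAut_liftAut σ₀).conjH1Primary T p u = u := by
    apply (modelIso K T p).injective
    rw [modelIso_conjH1Primary K T p σ₀ h2 hσ₀ u, ← hc]
    exact hufix_model
  -- file 1 §5 on the twist
  have h2u : 2 • u = 0 := two_nsmul_eq_zero_of_selmerPInfty_plus_of_selmer_rat_eq_bot T K p h2 hσ₀ hbot huSel hufix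
  rw [← hut, ← map_nsmul (hPsiK X K hθ₀Q hθ₀ p) 2 u, h2u, map_zero]

/-! ## §2 Odd `p`: the eigenparts vanish -/

/-- A `p`-primary element killed by `2` vanishes when `p` is odd. [folklore] -/
private theorem eq_zero_of_two_nsmul_of_pow_nsmul (hp : Odd p) {A : Type} [AddCommGroup A] {a : A}
    (h2a : 2 • a = 0) {k : ℕ} (hka : p ^ k • a = 0) : a = 0 := by
  have hodd : Odd (p ^ k) := hp.pow
  obtain ⟨m, hm⟩ := hodd
  have h : (2 * m) • a = 0 := by rw [mul_nsmul, h2a, nsmul_zero]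
  have h1 : (2 * m + 1) • a = a := by rw [add_nsmul, h, one_nsmul, zero_add]
  rw [← hm] at h1
  rw [← h1, hka]

/-- **Odd `p`, minus part: `Sel_{p^∞}(X^{(d_K)}/ℚ) = 0 ⟹ Sel_{p^∞}(X_K/K)^− = 0`** (every anti-fixed Selmer class vanishes): §1 and
`2` is invertible on the `p`-primary group `H¹(K, X_K[p^∞])` (`exists_pow_nsmul_eq_zero_galH1Primary`).  The `p^∞` companion of the
tree's finite-level `Sel_p(E^{(d_K)}/ℚ) ≅ Sel_p(E/K)^−`. [cite: GrossLMS1991, §5 (5.1)] [cite: Kramer1981, Thm. 1] -/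
theorem eq_zero_of_selmerPInfty_minus_of_twist_selmerPInfty_eq_bot_of_odd [IsGalois ℚ K] (hp : Odd p)
    (h2 : Module.finrank ℚ K = 2) {σ₀ : K ≃ₐ[ℚ] K} (hσ₀ : σ₀ ≠ 1)
    (hbot : selmerGroupPInfty (X.quadraticTwist (NumberField.discr K : ℚ)) p = ⊥)
    {t : galH1Primary (X.baseChange K) p} (ht : t ∈ selmerGroupPInfty (X.baseChange K) p)
    (hanti : (isLiftOfAut_liftAut σ₀).conjH1Primary X p t = -t) : t = 0 := by
  obtain ⟨k, hk⟩ := exists_pow_nsmul_eq_zero_galH1Primary (X.baseChange K) p t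
  exact eq_zero_of_two_nsmul_of_pow_nsmul p hp
    (two_nsmul_eq_zero_of_selmerPInfty_minus_of_twist_selmerPInfty_eq_bot X K p h2 hσ₀ hbot ht hanti) hk

/-- **Odd `p`, plus part: `Sel_{p^∞}(X/ℚ) = 0 ⟹ Sel_{p^∞}(X_K/K)^+ = 0`** (every `σ₀`-fixed Selmer class vanishes): file 1 §5
and `2` is invertible on a `p`-primary group.  The `p^∞` companion of the tree's `Sel_p(E/ℚ) ≅ Sel_p(E/K)^+`.
[cite: GrossLMS1991, §5 (5.1)] [cite: SerreGaloisCohomology1997, I.§2.4 Prop. 9] -/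
theorem eq_zero_of_selmerPInfty_plus_of_selmerPInfty_eq_bot_of_odd [IsGalois ℚ K] (hp : Odd p)
    (h2 : Module.finrank ℚ K = 2) {σ₀ : K ≃ₐ[ℚ] K} (hσ₀ : σ₀ ≠ 1) (hbot : selmerGroupPInfty X p = ⊥)
    {t : galH1Primary (X.baseChange K) p} (ht : t ∈ selmerGroupPInfty (X.baseChange K) p)
    (hfix : (isLiftOfAut_liftAut σ₀).conjH1Primary X p t = t) : t = 0 := by
  obtain ⟨k, hk⟩ := exists_pow_nsmul_eq_zero_galH1Primary (X.baseChange K) p t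
  exact eq_zero_of_two_nsmul_of_pow_nsmul p hp
    (two_nsmul_eq_zero_of_selmerPInfty_plus_of_selmer_rat_eq_bot X K p h2 hσ₀ hbot ht hfix) hk

/-! ## §3 The minus part with `Sel_{p^∞}(X^{(d_K)}/ℚ) = 0` from rank `0` and `Ш[p^∞] = 0` -/

/-- **`rank X^{(d_K)}(ℚ) = 0 ∧ Ш(X^{(d_K)}/ℚ)[p^∞] = 0 ⟹ 2·t = 0` for every anti-fixed `t ∈ Sel_{p^∞}(X_K/K)`** (`X`, `X^{(d_K)}`
elliptic; §1 with file 1 §1). [cite: GrossLMS1991, §5 (5.1)] [cite: Kramer1981, Thm. 1] [cite: Greenberg1999LNM, §2 pp. 62–63] -/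
theorem two_nsmul_eq_zero_of_selmerPInfty_minus_of_twinShaTrivial_of_twinRankZero [IsGalois ℚ K] [Fact p.Prime]
    (h2 : Module.finrank ℚ K = 2) {σ₀ : K ≃ₐ[ℚ] K} (hσ₀ : σ₀ ≠ 1)
    [(X.quadraticTwist (NumberField.discr K : ℚ)).IsElliptic]
    (hT0 : ∀ x ∈ AddCommGroup.primaryComponent (↥(X.quadraticTwist (NumberField.discr K : ℚ)).sha) p, x = 0)
    (hTrk : (X.quadraticTwist (NumberField.discr K : ℚ)).mordellWeilRank = 0)
    {t : galH1Primary (X.baseChange K) p} (ht : t ∈ selmerGroupPInfty (X.baseChange K) p)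
    (hanti : (isLiftOfAut_liftAut σ₀).conjH1Primary X p t = -t) : 2 • t = 0 := by
  haveI : Finite (X.quadraticTwist (NumberField.discr K : ℚ)).toAffine.Point :=
    ((X.quadraticTwist (NumberField.discr K : ℚ)).mordellWeilRank_eq_zero_iff_finite).mp hTrk
  exact two_nsmul_eq_zero_of_selmerPInfty_minus_of_twist_selmerPInfty_eq_bot X K p h2 hσ₀
    (selmerGroupPInfty_eq_bot_of_finite_of_shaPrimary _ p hT0) ht hanti

end Summit.BirchSwinnertonDyer.BirchSwinnertonDyer.Theorems.CMKolyvaginFirstDescentTwoOnGivenFrame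

end
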